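import Summits.Ventures.Crystal3D.StickySpheres.ConeLookup
import HarnessLib

/-!
# Cone-and-lookup certificates, chained form: several degree slices, separate lookup lists, surviving cones

Venture `Crystal3D` (cell `pub-crystal3d`, seat p3). Generalisation of `ConeLookup.graphStratum_of_testAll` to the shape of
the cell's `T(12)` Step 1 (p1 `T12-CHAIN.md`): the new vertex may have any degree `d ≤ d' ≤ D` (cones over a base list
`bases d'`, complete for `(d' − 1, e − d', m)`); a cone is refuted by deleting a vertex `w` of any degree `dw` for which a
lookup list `look dw` (complete for `(d − 1, e − dw, m)`) is supplied, using THREE invariants (degree histogram, triangle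
count, and the list of `(degree, triangles-at-vertex)` pairs `degTriB` up to permutation); a cone that is NOT refuted must
carry an explicit isomorphism (a permutation with its inverse, checked by the kernel) onto a listed TARGET table.
Conclusion (`completeList_of_testChain`): the targets form a complete list for `(d, e, m + 1)`.
HONEST FRAMING: [folklore] bookkeeping + kernel arithmetic; every list remains a hypothesis.
-/

namespace Summit.Ventures.Crystal3D

open Finset SimpleGraph

section Chain

variable {m : ℕ}

/-! ### 1. The third invariant: (degree, triangles-at-vertex) pairs up to permutation -/

/-- Ordered triangles at a vertex: `∑_{b,c} [v~b ∧ v~c ∧ b~c]`. [folklore] -/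
def triAt {V : Type*} [Fintype V] (G : SimpleGraph V) [DecidableRel G.Adj] (v : V) : ℕ :=
  ∑ b, ∑ c, if G.Adj v b ∧ G.Adj v c ∧ G.Adj b c then 1 else 0

/-- `triAt` is preserved by isomorphisms. [folklore] -/
theorem triAt_eq_of_iso {V W : Type*} [Fintype V] [Fintype W] {G : SimpleGraph V} {H : SimpleGraph W}
    [DecidableRel G.Adj] [DecidableRel H.Adj] (φ : G ≃g H) (v : V) : triAt H (φ v) = triAt G v := by
  unfold triAt
  rw [← Equiv.sum_comp φ.toEquiv]
  refine Finset.sum_congr rfl fun b _ => ?_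
  rw [← Equiv.sum_comp φ.toEquiv]
  refine Finset.sum_congr rfl fun c _ => ?_
  simp only [RelIso.coe_fn_toEquiv, Iso.map_adj_iff]

/-- Table form of `triAt`. [folklore] -/
def triAtB (adj : Fin m → Fin m → Bool) (v : Fin m) : ℕ :=
  ((List.finRange m).map fun b => (List.finRange m).countP fun c => adj v b && (adj v c && adj b c)).sum

/-- `triAt` of a table graph is `triAtB`. [folklore] -/
theorem triAt_boolGraph (adj : Fin m → Fin m → Bool) (hs : ∀ a b, adj a b = adj b a) (hl : ∀ a, adj a a = false)
    (v : Fin m) : triAt (boolGraph adj hs hl) v = triAtB adj v := by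
  unfold triAt triAtB
  rw [Fin.sum_univ_def]
  congr 1
  refine List.map_congr_left fun b _ => ?_
  rw [Finset.sum_boole, Nat.cast_id, card_filter_univ_eq_countP]
  congr 1
  funext c
  simp only [boolGraph_adj, Bool.decide_and, Bool.decide_eq_true]

/-- Degrees of a table graph are the row counts (`rowDeg` form). [folklore] -/
theorem degree_boolGraph' (adj : Fin m → Fin m → Bool) (hs : ∀ a b, adj a b = adj b a) (hl : ∀ a, adj a a = false)
    (v : Fin m) : (boolGraph adj hs hl).degree v = rowDeg adj v :=
  degree_boolGraph adj hs hl v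

/-- The list of `(degree, triangles-at-vertex)` pairs of a table. [folklore] -/
def degTriB (adj : Fin m → Fin m → Bool) : List (ℕ × ℕ) := (List.finRange m).map fun v => (rowDeg adj v, triAtB adj v)

/-- Isomorphic table graphs have `degTriB` lists that are permutations of each other. [folklore] -/
theorem degTriB_perm_of_iso {adj adj' : Fin m → Fin m → Bool} {hs hl hs' hl'}
    (φ : boolGraph adj hs hl ≃g boolGraph adj' hs' hl') : (degTriB adj).Perm (degTriB adj') := by
  have hf : (fun v => (rowDeg adj v, triAtB adj v)) = (fun w => (rowDeg adj' w, triAtB adj' w)) ∘ φ := by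
    funext v
    simp only [Function.comp_apply]
    have h1 : rowDeg adj v = rowDeg adj' (φ v) := by
      rw [← degree_boolGraph' adj hs hl v, ← degree_boolGraph' adj' hs' hl' (φ v), Iso.degree_eq]
    have h2 : triAtB adj v = triAtB adj' (φ v) := by
      rw [← triAt_boolGraph adj hs hl, ← triAt_boolGraph adj' hs' hl', triAt_eq_of_iso]
    rw [h1, h2]
  unfold degTriB
  rw [hf, ← List.map_map]
  refine List.Perm.map _ ?_
  refine List.perm_of_nodup_nodup_toFinset_eq (List.Nodup.map φ.injective (List.nodup_finRange m))
    (List.nodup_finRange m) ?_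
  ext x
  simp only [List.mem_toFinset, List.mem_map, List.mem_finRange, true_and, iff_true]
  exact ⟨φ.symm x, RelIso.apply_symm_apply φ x⟩

/-- `invNe3L a hb b`: the histogram of `a` differs from the CACHED histogram `hb.1` of `b`, or the triangle count of `a`
differs from the cached `hb.2`, or the `degTriB` lists of `a` and `b` are not permutations of each other. [folklore] -/
def invNe3L (a : Fin m → Fin m → Bool) (hb : List ℕ × ℕ) (b : Fin m → Fin m → Bool) : Bool :=
  !decide (histB a = hb.1) || (!decide (triB a = hb.2) || !decide ((degTriB a).Perm (degTriB b)))

/-- `invNe3L a (histB b, triB b) b = true` refutes `boolGraph a ≅ boolGraph b`. [folklore] -/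
theorem not_iso_of_invNe3L {adj adj' : Fin m → Fin m → Bool} {hs hl hs' hl'} {hb : List ℕ × ℕ}
    (hb1 : histB adj' = hb.1) (hb2 : triB adj' = hb.2) (h : invNe3L adj hb adj' = true)
    (φ : boolGraph adj hs hl ≃g boolGraph adj' hs' hl') : False := by
  simp only [invNe3L, Bool.or_eq_true, Bool.not_eq_true', decide_eq_false_iff_not] at h
  rcases h with h | h | h
  · exact h ((histB_eq_of_iso φ).trans hb1)
  · exact h ((triB_eq_of_iso φ).trans hb2)
  · exact h (degTriB_perm_of_iso φ)

/-- Boolean check "every row count of the table is `≥ d`". [folklore] -/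
def minDegOK (d : ℕ) (adj : Fin m → Fin m → Bool) : Bool := (List.finRange m).all fun a => decide (d ≤ rowDeg adj a)

/-! ### 2. Explicit isomorphisms from permutation data -/

/-- The function `Fin k → Fin k` encoded by a list of naturals (identity where the entry is out of range). [folklore] -/
def permFun {k : ℕ} (p : List ℕ) (i : Fin k) : Fin k :=
  if h : p.getD i.val 0 < k then ⟨p.getD i.val 0, h⟩ else i

/-- Boolean check that `(p, q)` encode mutually inverse maps carrying the table `a` onto the table `b`. [folklore] -/
def isoCheck {k : ℕ} (p q : List ℕ) (a b : Fin k → Fin k → Bool) : Bool :=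
  ((List.finRange k).all fun i => decide (permFun q (permFun p i) = i) && decide (permFun p (permFun q i) = i)) &&
  ((List.finRange k).all fun i => (List.finRange k).all fun j => decide (a i j = b (permFun p i) (permFun p j)))

/-- A passing `isoCheck` yields an isomorphism of the table graphs. [folklore] -/
def isoOfCheck {k : ℕ} {p q : List ℕ} {a b : Fin k → Fin k → Bool} {hsa hla hsb hlb} (h : isoCheck p q a b = true) :
    boolGraph a hsa hla ≃g boolGraph b hsb hlb where
  toEquiv :=
    { toFun := permFun p
      invFun := permFun q
      left_inv := fun i => by
        simp only [isoCheck, Bool.and_eq_true, List.all_eq_true, List.mem_finRange, true_implies,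
          decide_eq_true_eq] at h
        exact (h.1 i).1
      right_inv := fun i => by
        simp only [isoCheck, Bool.and_eq_true, List.all_eq_true, List.mem_finRange, true_implies,
          decide_eq_true_eq] at h
        exact (h.1 i).2 }
  map_rel_iff' := by
    intro i j
    simp only [isoCheck, Bool.and_eq_true, List.all_eq_true, List.mem_finRange, true_implies,
      decide_eq_true_eq] at h
    simp only [Equiv.coe_fn_mk, boolGraph_adj]
    rw [h.2 i j]

/-! ### 3. The chained certificate -/

/-- One cone `T ⊕ S` in the slice `d'`: discarded (`|S| ≠ d'` or a degree `< d'`), or refuted by some deletion `w` whose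
degree `dw ∈ lookDegs` has a lookup list all of whose tables are separated from `(T ⊕ S) − w` by `invNe3L` (cached
invariants `inv dw`), or matched by an entry `(d', k, c, t, p, q)` of `poss` giving an isomorphism onto target table `t`.
[folklore] -/
def testConeChain (d' k c : ℕ) (look : ℕ → List (List ℕ)) (inv : ℕ → List (List ℕ × ℕ)) (lookDegs : List ℕ)
    (tgt : List (List ℕ)) (poss : List (ℕ × ℕ × ℕ × ℕ × List ℕ × List ℕ)) (adj : Fin m → Fin m → Bool)
    (s : Fin m → Bool) : Bool :=
  !decide ((List.finRange m).countP s = d') ||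
  (!((List.finRange (m + 1)).all fun a => decide (d' ≤ rowDeg (coneAdjB adj s) a)) ||
  ((lookDegs.any fun dw => (List.finRange (m + 1)).any fun w => decide (rowDeg (coneAdjB adj s) w = dw) &&
    (List.range (look dw).length).all fun k' =>
      invNe3L (delAdj (coneAdjB adj s) w) ((inv dw).getD k' ([], 0)) (adjOfRows ((look dw).getD k' []))) ||
  (poss.any fun e => decide (e.1 = d') && (decide (e.2.1 = k) && (decide (e.2.2.1 = c) && (decide (e.2.2.2.1 < tgt.length) &&
    isoCheck e.2.2.2.2.1 e.2.2.2.2.2 (coneAdjB adj s) (adjOfRows (tgt.getD e.2.2.2.1 []) : Fin (m+1) → Fin (m+1) → Bool)))))))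

variable (m) in
/-- Certificate block 1: for every slice `d ≤ d' ≤ D`, every base table is a valid graph table with `e − d'` edges and —
unless some row count is `< d' − 1`, in which case no cone over it can have minimum degree `d'` — every cone over it passes
`testConeChain`. [folklore] -/
def testChainBases (d D e : ℕ) (bases look : ℕ → List (List ℕ)) (inv : ℕ → List (List ℕ × ℕ)) (lookDegs : List ℕ)
    (tgt : List (List ℕ)) (poss : List (ℕ × ℕ × ℕ × ℕ × List ℕ × List ℕ)) : Bool :=
  (List.range (D + 1 - d)).all fun i =>
    (List.range (bases (d + i)).length).all fun k =>
      tableOK (e - (d + i)) (adjOfRows ((bases (d + i)).getD k []) : Fin m → Fin m → Bool) &&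
      (!minDegOK (d + i - 1) (adjOfRows ((bases (d + i)).getD k []) : Fin m → Fin m → Bool) ||
      (List.range (2 ^ m)).all fun c =>
        testConeChain (d + i) k c look inv lookDegs tgt poss (adjOfRows ((bases (d + i)).getD k []) : Fin m → Fin m → Bool)
          (maskFun c))

variable (m) in
/-- Certificate block 2: every lookup table for `dw ∈ lookDegs` is a valid graph table with `e − dw` edges whose cached
invariants `inv dw` are correct. [folklore] -/
def testChainLooks (e : ℕ) (look : ℕ → List (List ℕ)) (inv : ℕ → List (List ℕ × ℕ)) (lookDegs : List ℕ) : Bool :=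
  lookDegs.all fun dw => (List.range (look dw).length).all fun k =>
    tableOK (e - dw) (adjOfRows ((look dw).getD k []) : Fin m → Fin m → Bool) &&
    (decide (histB (adjOfRows ((look dw).getD k []) : Fin m → Fin m → Bool) = ((inv dw).getD k ([], 0)).1) &&
    decide (triB (adjOfRows ((look dw).getD k []) : Fin m → Fin m → Bool) = ((inv dw).getD k ([], 0)).2))

variable (m) in
/-- Certificate block 3: every target table (on `Fin (m + 1)`) is symmetric and irreflexive. [folklore] -/
def testChainTgts (tgt : List (List ℕ)) : Bool :=
  (List.range tgt.length).all fun t =>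
    symmB (adjOfRows (tgt.getD t []) : Fin (m + 1) → Fin (m + 1) → Bool) &&
    irreflB (adjOfRows (tgt.getD t []) : Fin (m + 1) → Fin (m + 1) → Bool)

variable (m) in
/-- **The chained certificate** = the three blocks. [folklore] -/
def testChain (d D e : ℕ) (bases look : ℕ → List (List ℕ)) (inv : ℕ → List (List ℕ × ℕ)) (lookDegs : List ℕ)
    (tgt : List (List ℕ)) (poss : List (ℕ × ℕ × ℕ × ℕ × List ℕ × List ℕ)) : Bool :=
  testChainBases m d D e bases look inv lookDegs tgt poss && testChainLooks m e look inv lookDegs && testChainTgts m tgt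

end Chain

/-! ### 3b. Splitting the base block by slices (separate kernel runs) -/

/-- The base block for slices `d..D` follows from the block for the single slice `d` and the block for `d+1..D`.
[folklore] -/
theorem testChainBases_cons {m d D e : ℕ} {bases look : ℕ → List (List ℕ)} {inv : ℕ → List (List ℕ × ℕ)}
    {lookDegs : List ℕ} {tgt : List (List ℕ)} {poss : List (ℕ × ℕ × ℕ × ℕ × List ℕ × List ℕ)}
    (h0 : testChainBases m d d e bases look inv lookDegs tgt poss = true)
    (h1 : testChainBases m (d + 1) D e bases look inv lookDegs tgt poss = true) :
    testChainBases m d D e bases look inv lookDegs tgt poss = true := by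
  rw [testChainBases, List.all_eq_true] at h0 h1 ⊢
  intro i hi
  rcases Nat.eq_zero_or_pos i with rfl | hpos
  · exact h0 0 (List.mem_range.2 (by omega))
  · obtain ⟨j, rfl⟩ : ∃ j, i = j + 1 := ⟨i - 1, by omega⟩
    have hj := h1 j (List.mem_range.2 (by have := List.mem_range.1 hi; omega))
    rw [show d + 1 + j = d + (j + 1) by omega] at hj
    exact hj

/-- Assembling `testChain` from its blocks. [folklore] -/
theorem testChain_of_blocks {m d D e : ℕ} {bases look : ℕ → List (List ℕ)} {inv : ℕ → List (List ℕ × ℕ)}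
    {lookDegs : List ℕ} {tgt : List (List ℕ)} {poss : List (ℕ × ℕ × ℕ × ℕ × List ℕ × List ℕ)}
    (hB : testChainBases m d D e bases look inv lookDegs tgt poss = true)
    (hL : testChainLooks m e look inv lookDegs = true) (hT : testChainTgts m tgt = true) :
    testChain m d D e bases look inv lookDegs tgt poss = true := by
  rw [testChain, hB, hL, hT]
  rfl

/-! ### 4. Soundness -/

/-- In a cone with all degrees `≥ d'`, every base row count is `≥ d' − 1`. [folklore] -/
theorem minDegOK_of_cone {m d' : ℕ} {adj : Fin m → Fin m → Bool} (hs : ∀ a b, adj a b = adj b a)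
    (hl : ∀ a, adj a a = false) (S : Finset (Fin m))
    (hmin : ∀ a, d' ≤ (coneGraph (Fin.last m) (boolGraph adj hs hl) S).degree a) : minDegOK (d' - 1) adj = true := by
  rw [minDegOK, List.all_eq_true]
  intro a _
  rw [decide_eq_true_eq, ← degree_boolGraph' adj hs hl a]
  have h := hmin ((Fin.last m).succAbove a)
  rw [degree_coneGraph_succAbove] at h
  split_ifs at h <;> omega

/-- **Soundness of chained certificates.** Let `D ≤ e`, `2e < (D + 1)(m + 1)` and `testChain m d D e bases look inv lookDegs
tgt poss = true`. If for every `d ≤ d' ≤ D` the graphs of `bases d'` are a complete list for `(d' − 1, e − d', m)` and for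
every `dw ∈ lookDegs` the graphs of `look dw` are a complete list for `(d − 1, e − dw, m)`, then the graphs of `tgt` are a
complete list for `(d, e, m + 1)`. [folklore] -/
theorem completeList_of_testChain {m d D e : ℕ} (bases look : ℕ → List (List ℕ)) (inv : ℕ → List (List ℕ × ℕ))
    (lookDegs : List ℕ) (tgt : List (List ℕ)) (poss : List (ℕ × ℕ × ℕ × ℕ × List ℕ × List ℕ)) (hDe : D ≤ e)
    (hD : 2 * e < (D + 1) * (m + 1))
    (hcheck : testChain m d D e bases look inv lookDegs tgt poss = true)
    (hBase : ∀ d', d ≤ d' → d' ≤ D → CompleteListHypothesis (d' - 1) (e - d') m (tableSet m (bases d')))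
    (hLook : ∀ dw ∈ lookDegs, CompleteListHypothesis (d - 1) (e - dw) m (tableSet m (look dw))) :
    CompleteListHypothesis d e (m + 1) (tableSet (m + 1) tgt) := by
  -- unpack the three blocks of the certificate
  obtain ⟨hBL, hTg⟩ := Bool.and_eq_true_iff.1 hcheck
  obtain ⟨hB, hL⟩ := Bool.and_eq_true_iff.1 hBL
  rw [testChainBases] at hB
  rw [testChainLooks] at hL
  rw [testChainTgts] at hTg
  have hSlice : ∀ d', d ≤ d' → d' ≤ D → ∀ k, k < (bases d').length →
      tableOK (e - d') (adjOfRows ((bases d').getD k []) : Fin m → Fin m → Bool) = true ∧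
      (minDegOK (d' - 1) (adjOfRows ((bases d').getD k []) : Fin m → Fin m → Bool) = true →
        ∀ c, c ∈ List.range (2 ^ m) → testConeChain d' k c look inv lookDegs tgt poss
          (adjOfRows ((bases d').getD k []) : Fin m → Fin m → Bool) (maskFun c) = true) := by
    intro d' h1 h2 k hk
    have h := List.all_eq_true.1 hB (d' - d) (List.mem_range.2 (by omega))
    rw [show d + (d' - d) = d' by omega, List.all_eq_true] at h
    have h' := h k (List.mem_range.2 hk)
    obtain ⟨h'1, h'2⟩ := Bool.and_eq_true_iff.1 h'
    refine ⟨h'1, fun hmd c hc => ?_⟩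
    rw [Bool.or_eq_true, hmd] at h'2
    rcases h'2 with h'2 | h'2
    · exact absurd h'2 (by decide)
    · exact List.all_eq_true.1 h'2 c hc
  have hLookOK : ∀ dw ∈ lookDegs, ∀ k, k < (look dw).length →
      symmB (adjOfRows ((look dw).getD k []) : Fin m → Fin m → Bool) = true ∧
      irreflB (adjOfRows ((look dw).getD k []) : Fin m → Fin m → Bool) = true ∧
      histB (adjOfRows ((look dw).getD k []) : Fin m → Fin m → Bool) = ((inv dw).getD k ([], 0)).1 ∧
      triB (adjOfRows ((look dw).getD k []) : Fin m → Fin m → Bool) = ((inv dw).getD k ([], 0)).2 := by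
    intro dw hdw k hk
    have h := List.all_eq_true.1 (List.all_eq_true.1 hL dw hdw) k (List.mem_range.2 hk)
    obtain ⟨hX, hAB⟩ := Bool.and_eq_true_iff.1 h
    obtain ⟨hSI, -⟩ := Bool.and_eq_true_iff.1 hX
    obtain ⟨hks, hkl⟩ := Bool.and_eq_true_iff.1 hSI
    obtain ⟨h2, h3⟩ := Bool.and_eq_true_iff.1 hAB
    exact ⟨hks, hkl, of_decide_eq_true h2, of_decide_eq_true h3⟩
  have hTgtOK : ∀ t, t < tgt.length →
      symmB (adjOfRows (tgt.getD t []) : Fin (m + 1) → Fin (m + 1) → Bool) = true ∧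
      irreflB (adjOfRows (tgt.getD t []) : Fin (m + 1) → Fin (m + 1) → Bool) = true := by
    intro t ht
    have h := List.all_eq_true.1 hTg t (List.mem_range.2 ht)
    exact Bool.and_eq_true_iff.1 h
  refine completeList_succ_of_coneExtensions (n := m) (e := e) (d := d) (D := D) hD
    (fun d' => tableSet m (bases d')) (tableSet (m + 1) tgt) hBase ?_
  intro d' h1 h2 H hH inst S hS hmin hRR
  obtain ⟨k, hk, rfl⟩ := hH
  obtain ⟨hOKk, hcones⟩ := hSlice d' h1 h2 k hk
  obtain ⟨hkk, hksum'⟩ := Bool.and_eq_true_iff.1 hOKk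
  obtain ⟨hks, hkl⟩ := Bool.and_eq_true_iff.1 hkk
  have hksum := of_decide_eq_true hksum'
  set adj : Fin m → Fin m → Bool := adjOfRows ((bases d').getD k []) with hadj
  have hT : tableGraph m ((bases d').getD k []) = boolGraph adj (symm_of_symmB hks) (irrefl_of_irreflB hkl) :=
    tableGraph_eq hks hkl
  -- the base passes the row-count filter (else the cone could not have minimum degree d')
  have hmd : minDegOK (d' - 1) adj = true := by
    refine minDegOK_of_cone (symm_of_symmB hks) (irrefl_of_irreflB hkl) S fun a => ?_
    rw [← degree_congr_of_eq (congrArg (fun X => coneGraph (Fin.last m) X S) hT) a]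
    exact hmin a
  set s : Fin m → Bool := fun i => decide (i ∈ S) with hs
  let G' : SimpleGraph (Fin (m + 1)) :=
    boolGraph (coneAdjB adj s) (coneAdjB_symm _ (symm_of_symmB hks) s) (coneAdjB_irrefl _ (irrefl_of_irreflB hkl) s)
  have hEq : coneGraph (Fin.last m) (tableGraph m ((bases d').getD k [])) S = G' := by
    rw [hT]
    conv_lhs => rw [eq_filter_decide_mem S]
    exact coneGraph_boolGraph adj _ _ s
  have hdegG' : ∀ a, G'.degree a = rowDeg (coneAdjB adj s) a := fun a => degree_boolGraph _ _ _ a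
  have hmin' : ∀ a, d' ≤ G'.degree a := fun a => by
    rw [← degree_congr_of_eq hEq a]
    exact hmin a
  have hRR' : RelaxedRealisable G' := hEq ▸ hRR
  have hE0 : (boolGraph adj (symm_of_symmB hks) (irrefl_of_irreflB hkl)).edgeFinset.card = e - d' := by
    have h := two_mul_card_edgeFinset_boolGraph adj (symm_of_symmB hks) (irrefl_of_irreflB hkl)
    rw [hksum] at h
    omega
  have hdeg_le : d' ≤ e := le_trans h2 hDe
  have hcardG' : G'.edgeFinset.card = e := by
    rw [← card_edgeFinset_congr_of_eq hEq, card_edgeFinset_coneGraph, card_edgeFinset_congr_of_eq hT, hE0, hS]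
    omega
  -- the certificate line for this cone
  have ht := hcones hmd (∑ j ∈ S, 2 ^ (j : ℕ)) (sum_two_pow_val_mem_range S)
  rw [maskFun_sum_two_pow, ← hs] at ht
  have hc1 : (List.finRange m).countP s = d' := by rw [hs, ← card_eq_countP_decide_mem S, hS]
  have hc2 : ((List.finRange (m + 1)).all fun a => decide (d' ≤ rowDeg (coneAdjB adj s) a)) = true := by
    rw [List.all_eq_true]
    intro a _
    rw [decide_eq_true_eq, ← hdegG' a]
    exact hmin' a
  rw [testConeChain, hc1, hc2] at ht
  simp only [decide_true, Bool.not_true, Bool.false_or, Bool.or_eq_true] at ht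
  rcases ht with ht | ht
  · -- refuted by a lookup
    exfalso
    simp only [List.any_eq_true, Bool.and_eq_true, decide_eq_true_eq, List.all_eq_true, List.mem_range] at ht
    obtain ⟨dw, hdw, w, -, hwdw, hall⟩ := ht
    rw [← hdegG' w] at hwdw
    have hdel : G'.comap w.succAbove = boolGraph (delAdj (coneAdjB adj s) w)
        (fun _ _ => coneAdjB_symm _ (symm_of_symmB hks) s _ _)
        (fun _ => coneAdjB_irrefl _ (irrefl_of_irreflB hkl) s _) :=
      comap_boolGraph _ _ _ _
    have he : (G'.comap w.succAbove).edgeFinset.card = e - dw := by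
      rw [card_edgeFinset_comap_succAbove, hcardG', hwdw]
    have hdg : ∀ j, d - 1 ≤ (G'.comap w.succAbove).degree j := fun j =>
      le_trans (by have := hmin' (w.succAbove j); omega) (degree_sub_one_le_degree_comap_succAbove G' w j)
    obtain ⟨X, hX, ⟨φ⟩⟩ := hLook dw hdw (G'.comap w.succAbove) he hdg (hRR'.deleteVertex w)
    obtain ⟨k', hk', rfl⟩ := hX
    obtain ⟨hks', hkl', hh', ht'⟩ := hLookOK dw hdw k' hk'
    have ψ := ((isoOfEq hdel).symm.trans φ).trans (isoOfEq (tableGraph_eq hks' hkl'))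
    exact not_iso_of_invNe3L hh' ht' (hall k' hk') ψ
  · -- matched by an explicit isomorphism onto a target
    simp only [List.any_eq_true, Bool.and_eq_true, decide_eq_true_eq] at ht
    obtain ⟨en, -, -, -, -, htl, hiso⟩ := ht
    obtain ⟨htks, htkl⟩ := hTgtOK _ htl
    refine ⟨tableGraph (m + 1) (tgt.getD en.2.2.2.1 []), ⟨en.2.2.2.1, htl, rfl⟩, ⟨?_⟩⟩
    rw [hEq, tableGraph_eq htks htkl]
    exact isoOfCheck hiso

end Summit.Ventures.Crystal3D
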